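import Summits.BirchSwinnertonDyer.BirchSwinnertonDyer.Theorems.GenusKolyvaginAtTwoMinimalTwinBSDTwoKrizLiAnchorWallSS
import Summits.BirchSwinnertonDyer.BirchSwinnertonDyer.Theorems.GenusKolyvaginAtTwoMinimalTwinBSDTwoKrizLiAnchor123a1
import Summits.BirchSwinnertonDyer.BirchSwinnertonDyer.Theorems.GenusKolyvaginAtTwoMinimalTwinBSDTwoKrizLiAnchor123b1
import Summits.BirchSwinnertonDyer.BirchSwinnertonDyer.Theorems.GenusKolyvaginAtTwoMinimalTwinBSDTwoKrizLiAnchor141a1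
import Summits.BirchSwinnertonDyer.BirchSwinnertonDyer.Theorems.GenusKolyvaginAtTwoMinimalTwinBSDTwoKrizLiAnchor141d1
import HarnessLib

/-!
# Route `GenusKolyvaginAtTwo`, crux U₂ `MinimalTwinBSDTwo` (stmt-BirchSwinnertonDyer-22985), LINE 23 «twin_swap»: THE KRIZ–LI PACKETS OF THE
# SQUARE-FREE-CONDUCTOR ANCHORS `123a1`, `123b1`, `141a1`, `141d1` ARE U₂-SETTLED MODULO PRINT + THE SUPERSINGULAR
# WALL ROW ALONE (item 19097) — all GOOD SUPERSINGULAR at `2` (`a₁ = 0` on the minimal model), so their companions are too (`…KrizLiAnchorWallSS.lean`)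

Seat `bsd-line-gk2-p2` g34 (PROVER 2/3, cell `bsd-f1-sign2`; LINE 23 holder), `--supports stmt-BirchSwinnertonDyer-22985` (helper; closes nothing).
THEOREMS ONLY (0 `def`, 0 `sorry`); standard axioms; route-independent (the supersingular wall row is DISPLAYED as `hSS` in the unfolded shape of
`Theses.ByReductionTypeAtTwo.SupersingularRankZeroAtTwo`; feed that item by name).  Companion of `…KrizLiAnchorsSupersingularWall.lean` (anchors 101a1,
131a1, 163a1).  Per anchor: `goodSS_two_<T>` (kernel: `a₁ = 0`, good at `2`) and the sorting theorems `rankOneMembers_<T>_of_ssWall` /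
`rankZeroCompanions_<T>_of_ssWall` / the witness member, with ONE research input (item 19097) plus PRINT (Kriz–Li Thm 5.1 (2) / 4.3, the Table-1 row,
Creutz–Miller on the base, GZK for `r_an = 1`).  Together with `37a1`/`43a1` (PRINT alone) and `101a1`/`131a1`/`163a1` this covers ALL THIRTEEN semistable
good-at-`2` rank-one anchors of Kriz–Li's Table 1 with `c₂` odd.  **BSD is NOT proved by any of this; U₂ is NOT proved; item 19097 is OPEN; no item is closed.**

References: [KrizLi2019] Thm 5.1 (2), Thm 4.3, §6 Ex. 6.2, Table 1; [CreutzMiller2012] Thm 1.1; [SilvermanAEC2009] V.4, X.2 Prop. 2.4; [Pal2012] Prop. 2.5.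
-/

set_option autoImplicit false
-- the Theorems namespace of this sub repeats the summit name by design (D-0017 nested layout)
set_option linter.dupNamespace false

noncomputable section

open scoped Classical

open WeierstrassCurve NumberField Literature.NumberTheory.EllipticCurves
  Literature.NumberTheory.EllipticCurves.ModularForms
  Literature.NumberTheory.EllipticCurves.Rank1Residual
  Literature.NumberTheory.EllipticCurves.Rank1Residual.Typed
  Summit.BirchSwinnertonDyer.Rank1Residual
  Summit.BirchSwinnertonDyer.Rank1Residual.P2
  Summit.BirchSwinnertonDyer.BirchSwinnertonDyer.Theorems.AddPotGoodPrint
  Summit.BirchSwinnertonDyer.BirchSwinnertonDyer.Theorems.GenusExact.TwinSwap.KrizLiAnchorWall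

namespace Summit.BirchSwinnertonDyer.BirchSwinnertonDyer.Theorems.GenusExact.TwinSwap.KrizLiAnchorsSSIIa

/-! ## `123a1` -/
section A123A1
open Summit.BirchSwinnertonDyer.BirchSwinnertonDyer.Theorems.GenusExact.TwinSwap.KrizLiAnchor123a1

/-- **`123a1` is good SUPERSINGULAR at `2`** (`a₁ = 0` on the minimal model, good reduction at `2`). [cite: SilvermanAEC2009, V.4] [cite: KrizLi2019, §6 Example 6.2 and Table 1 (row 123a1)] -/
theorem goodSS_two_123A1 :
    haveI := isGloballyMinimal_123A1; haveI : Fact (Nat.Prime 2) := ⟨Nat.prime_two⟩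
    GoodSS (⟨0, 1, 1, -10, 10⟩ : WeierstrassCurve ℚ) 2 := by
  haveI := isElliptic_123A1; haveI := isGloballyMinimal_123A1
  exact goodSS_two_of_even_a₁ _ hasGoodReductionAtPrime_two_123A1 (by rw [intModel_123A1]; exact ⟨0, rfl⟩)

/-- ★ **THE RANK-ONE MEMBERS `123a1^{(d)}` — U₂-class curves settled MODULO PRINT + THE SUPERSINGULAR WALL ROW (19097) ALONE**: at every global minimal
`W₁ ≅ 123a1^{(d)}` (`d ∈ 𝒩(123a1, K)`, `d_K = -23`, `χ_d(−123) = 1`): `r_an(W₁) = 1 ∧ ¬CM ∧ BSD(W₁, 2)`.  BSD is not proved by any of this; U₂ is not proved.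
[cite: KrizLi2019, Thm. 5.1 (2), Thm. 4.3, §6 Table 1 (row 123a1)] [cite: CreutzMiller2012, Thm. 1.1] -/
theorem rankOneMembers_123A1_of_ssWall (hKL : KrizLi2019.thm112_bsdTwo_twist) (h33 : KrizLi2019.thm33_rank_twist)
    (htab : KrizLi2019.table1_row123a1) (hS31 : bsdTriple_of_analyticRank_le_one_of_conductor_lt)
    (hGZK : rank_eq_analyticRank_of_analyticRank_le_one)
    (hSS : ∀ (W : WeierstrassCurve ℚ) [W.IsElliptic] [W.IsGloballyMinimal], ¬ W.HasCM → W.analyticRank = 0 →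
      (haveI : Fact (Nat.Prime 2) := ⟨Nat.prime_two⟩; GoodSS W 2) → BSDp W 2)
    (K : Type) [Field K] [NumberField K] (hK : IsImaginaryQuadratic K) (hdK : NumberField.discr K = -23)
    {d : ℤ} (hd : haveI := isGloballyMinimal_123A1; KrizLi2019.InN (⟨0, 1, 1, -10, 10⟩ : WeierstrassCurve ℚ) K d)
    (hsign : haveI := isElliptic_123A1; Int.sign d * jacobiSym ((⟨0, 1, 1, -10, 10⟩ : WeierstrassCurve ℚ).conductorNorm ℤ) d.natAbs = 1)
    (W₁ : WeierstrassCurve ℚ) [W₁.IsElliptic] [W₁.IsGloballyMinimal]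
    (hW₁ : ∃ C : VariableChange ℚ, C • (⟨0, 1, 1, -10, 10⟩ : WeierstrassCurve ℚ).quadraticTwist (d : ℚ) = W₁) :
    W₁.analyticRank = 1 ∧ ¬ W₁.HasCM ∧ BSDp W₁ 2 := by
  haveI := isElliptic_123A1; haveI := isGloballyMinimal_123A1
  obtain ⟨_, Dt, H, ι, P, j, -, hP, hstar⟩ := htab K hK hdK
  exact rankOneMembers_of_ssWall _ hKL h33 hS31 hSS goodSS_two_123A1 conductorNorm_lt_5000_123A1 not_hasCM_123A1 (analyticRank_123A1 h33 htab hGZK)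
    twoTorsion_123A1 K hK (by rw [hdK]; decide) (satisfiesHeegnerHypothesis_123A1 hK.1 hdK) Dt H ι P hP j hstar (krizLi_loc_123A1 Dt) hd hsign W₁ hW₁

/-- **THE RANK-ZERO COMPANIONS `123a1^{(-23d)}`** under the supersingular wall row: `r_an = 0 ∧ ¬CM ∧ GoodSS ∧ BSD(·, 2)` — members of item 19097's own class.
BSD is not proved by any of this. [cite: KrizLi2019, Thm. 5.1 (2), Thm. 4.3, §6 Table 1 (row 123a1)] [cite: CreutzMiller2012, Thm. 1.1] -/
theorem rankZeroCompanions_123A1_of_ssWall (hKL : KrizLi2019.thm112_bsdTwo_twist) (h33 : KrizLi2019.thm33_rank_twist)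
    (htab : KrizLi2019.table1_row123a1) (hS31 : bsdTriple_of_analyticRank_le_one_of_conductor_lt)
    (hGZK : rank_eq_analyticRank_of_analyticRank_le_one)
    (hSS : ∀ (W : WeierstrassCurve ℚ) [W.IsElliptic] [W.IsGloballyMinimal], ¬ W.HasCM → W.analyticRank = 0 →
      (haveI : Fact (Nat.Prime 2) := ⟨Nat.prime_two⟩; GoodSS W 2) → BSDp W 2)
    (K : Type) [Field K] [NumberField K] (hK : IsImaginaryQuadratic K) (hdK : NumberField.discr K = -23)
    {d : ℤ} (hd : haveI := isGloballyMinimal_123A1; KrizLi2019.InN (⟨0, 1, 1, -10, 10⟩ : WeierstrassCurve ℚ) K d)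
    (hsign : haveI := isElliptic_123A1; Int.sign d * jacobiSym ((⟨0, 1, 1, -10, 10⟩ : WeierstrassCurve ℚ).conductorNorm ℤ) d.natAbs = 1)
    (W₂ : WeierstrassCurve ℚ) [W₂.IsElliptic] [W₂.IsGloballyMinimal]
    (hW₂ : ∃ C : VariableChange ℚ, C • (⟨0, 1, 1, -10, 10⟩ : WeierstrassCurve ℚ).quadraticTwist ((d * NumberField.discr K : ℤ) : ℚ) = W₂) :
    haveI : Fact (Nat.Prime 2) := ⟨Nat.prime_two⟩
    W₂.analyticRank = 0 ∧ ¬ W₂.HasCM ∧ GoodSS W₂ 2 ∧ BSDp W₂ 2 := by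
  haveI := isElliptic_123A1; haveI := isGloballyMinimal_123A1
  obtain ⟨_, Dt, H, ι, P, j, -, hP, hstar⟩ := htab K hK hdK
  exact rankZeroCompanions_of_ssWall _ hKL h33 hS31 hSS goodSS_two_123A1 conductorNorm_lt_5000_123A1 not_hasCM_123A1 (analyticRank_123A1 h33 htab hGZK)
    twoTorsion_123A1 K hK (by rw [hdK]; decide) (satisfiesHeegnerHypothesis_123A1 hK.1 hdK) Dt H ι P hP j hstar (krizLi_loc_123A1 Dt) hd hsign W₂ hW₂

/-- **The witness member `123a1^{(29)}`** (rank one): `r_an = 1 ∧ ¬CM ∧ BSD(·, 2)` modulo PRINT + item 19097. BSD is not proved by any of this.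
[cite: KrizLi2019, Thm. 5.1 (2), Thm. 4.3, §6 Table 1 (row 123a1)] [cite: CreutzMiller2012, Thm. 1.1] -/
theorem rankOneMember_witness_123A1_of_ssWall (hKL : KrizLi2019.thm112_bsdTwo_twist) (h33 : KrizLi2019.thm33_rank_twist)
    (htab : KrizLi2019.table1_row123a1) (hS31 : bsdTriple_of_analyticRank_le_one_of_conductor_lt)
    (hGZK : rank_eq_analyticRank_of_analyticRank_le_one)
    (hSS : ∀ (W : WeierstrassCurve ℚ) [W.IsElliptic] [W.IsGloballyMinimal], ¬ W.HasCM → W.analyticRank = 0 →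
      (haveI : Fact (Nat.Prime 2) := ⟨Nat.prime_two⟩; GoodSS W 2) → BSDp W 2)
    (K : Type) [Field K] [NumberField K] (hK : IsImaginaryQuadratic K) (hdK : NumberField.discr K = -23)
    (W₁ : WeierstrassCurve ℚ) [W₁.IsElliptic] [W₁.IsGloballyMinimal]
    (hW₁ : ∃ C : VariableChange ℚ, C • (⟨0, 1, 1, -10, 10⟩ : WeierstrassCurve ℚ).quadraticTwist ((29 : ℤ) : ℚ) = W₁) :
    W₁.analyticRank = 1 ∧ ¬ W₁.HasCM ∧ BSDp W₁ 2 :=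
  rankOneMembers_123A1_of_ssWall hKL h33 htab hS31 hGZK hSS K hK hdK (inN_witness_123A1 hK.1 hdK) sign_witness_123A1 W₁ hW₁

end A123A1

/-! ## `123b1` -/
section A123B1
open Summit.BirchSwinnertonDyer.BirchSwinnertonDyer.Theorems.GenusExact.TwinSwap.KrizLiAnchor123b1

/-- **`123b1` is good SUPERSINGULAR at `2`** (`a₁ = 0` on the minimal model, good reduction at `2`). [cite: SilvermanAEC2009, V.4] [cite: KrizLi2019, §6 Example 6.2 and Table 1 (row 123b1)] -/
theorem goodSS_two_123B1 :
    haveI := isGloballyMinimal_123B1; haveI : Fact (Nat.Prime 2) := ⟨Nat.prime_two⟩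
    GoodSS (⟨0, -1, 1, 1, -1⟩ : WeierstrassCurve ℚ) 2 := by
  haveI := isElliptic_123B1; haveI := isGloballyMinimal_123B1
  exact goodSS_two_of_even_a₁ _ hasGoodReductionAtPrime_two_123B1 (by rw [intModel_123B1]; exact ⟨0, rfl⟩)

/-- ★ **THE RANK-ONE MEMBERS `123b1^{(d)}` — U₂-class curves settled MODULO PRINT + THE SUPERSINGULAR WALL ROW (19097) ALONE**: at every global minimal
`W₁ ≅ 123b1^{(d)}` (`d ∈ 𝒩(123b1, K)`, `d_K = -23`, `χ_d(−123) = 1`): `r_an(W₁) = 1 ∧ ¬CM ∧ BSD(W₁, 2)`.  BSD is not proved by any of this; U₂ is not proved.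
[cite: KrizLi2019, Thm. 5.1 (2), Thm. 4.3, §6 Table 1 (row 123b1)] [cite: CreutzMiller2012, Thm. 1.1] -/
theorem rankOneMembers_123B1_of_ssWall (hKL : KrizLi2019.thm112_bsdTwo_twist) (h33 : KrizLi2019.thm33_rank_twist)
    (htab : KrizLi2019.table1_row123b1) (hS31 : bsdTriple_of_analyticRank_le_one_of_conductor_lt)
    (hGZK : rank_eq_analyticRank_of_analyticRank_le_one)
    (hSS : ∀ (W : WeierstrassCurve ℚ) [W.IsElliptic] [W.IsGloballyMinimal], ¬ W.HasCM → W.analyticRank = 0 →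
      (haveI : Fact (Nat.Prime 2) := ⟨Nat.prime_two⟩; GoodSS W 2) → BSDp W 2)
    (K : Type) [Field K] [NumberField K] (hK : IsImaginaryQuadratic K) (hdK : NumberField.discr K = -23)
    {d : ℤ} (hd : haveI := isGloballyMinimal_123B1; KrizLi2019.InN (⟨0, -1, 1, 1, -1⟩ : WeierstrassCurve ℚ) K d)
    (hsign : haveI := isElliptic_123B1; Int.sign d * jacobiSym ((⟨0, -1, 1, 1, -1⟩ : WeierstrassCurve ℚ).conductorNorm ℤ) d.natAbs = 1)
    (W₁ : WeierstrassCurve ℚ) [W₁.IsElliptic] [W₁.IsGloballyMinimal]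
    (hW₁ : ∃ C : VariableChange ℚ, C • (⟨0, -1, 1, 1, -1⟩ : WeierstrassCurve ℚ).quadraticTwist (d : ℚ) = W₁) :
    W₁.analyticRank = 1 ∧ ¬ W₁.HasCM ∧ BSDp W₁ 2 := by
  haveI := isElliptic_123B1; haveI := isGloballyMinimal_123B1
  obtain ⟨_, Dt, H, ι, P, j, -, hP, hstar⟩ := htab K hK hdK
  exact rankOneMembers_of_ssWall _ hKL h33 hS31 hSS goodSS_two_123B1 conductorNorm_lt_5000_123B1 not_hasCM_123B1 (analyticRank_123B1 h33 htab hGZK)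
    twoTorsion_123B1 K hK (by rw [hdK]; decide) (satisfiesHeegnerHypothesis_123B1 hK.1 hdK) Dt H ι P hP j hstar (krizLi_loc_123B1 Dt) hd hsign W₁ hW₁

/-- **THE RANK-ZERO COMPANIONS `123b1^{(-23d)}`** under the supersingular wall row: `r_an = 0 ∧ ¬CM ∧ GoodSS ∧ BSD(·, 2)` — members of item 19097's own class.
BSD is not proved by any of this. [cite: KrizLi2019, Thm. 5.1 (2), Thm. 4.3, §6 Table 1 (row 123b1)] [cite: CreutzMiller2012, Thm. 1.1] -/
theorem rankZeroCompanions_123B1_of_ssWall (hKL : KrizLi2019.thm112_bsdTwo_twist) (h33 : KrizLi2019.thm33_rank_twist)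
    (htab : KrizLi2019.table1_row123b1) (hS31 : bsdTriple_of_analyticRank_le_one_of_conductor_lt)
    (hGZK : rank_eq_analyticRank_of_analyticRank_le_one)
    (hSS : ∀ (W : WeierstrassCurve ℚ) [W.IsElliptic] [W.IsGloballyMinimal], ¬ W.HasCM → W.analyticRank = 0 →
      (haveI : Fact (Nat.Prime 2) := ⟨Nat.prime_two⟩; GoodSS W 2) → BSDp W 2)
    (K : Type) [Field K] [NumberField K] (hK : IsImaginaryQuadratic K) (hdK : NumberField.discr K = -23)
    {d : ℤ} (hd : haveI := isGloballyMinimal_123B1; KrizLi2019.InN (⟨0, -1, 1, 1, -1⟩ : WeierstrassCurve ℚ) K d)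
    (hsign : haveI := isElliptic_123B1; Int.sign d * jacobiSym ((⟨0, -1, 1, 1, -1⟩ : WeierstrassCurve ℚ).conductorNorm ℤ) d.natAbs = 1)
    (W₂ : WeierstrassCurve ℚ) [W₂.IsElliptic] [W₂.IsGloballyMinimal]
    (hW₂ : ∃ C : VariableChange ℚ, C • (⟨0, -1, 1, 1, -1⟩ : WeierstrassCurve ℚ).quadraticTwist ((d * NumberField.discr K : ℤ) : ℚ) = W₂) :
    haveI : Fact (Nat.Prime 2) := ⟨Nat.prime_two⟩
    W₂.analyticRank = 0 ∧ ¬ W₂.HasCM ∧ GoodSS W₂ 2 ∧ BSDp W₂ 2 := by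
  haveI := isElliptic_123B1; haveI := isGloballyMinimal_123B1
  obtain ⟨_, Dt, H, ι, P, j, -, hP, hstar⟩ := htab K hK hdK
  exact rankZeroCompanions_of_ssWall _ hKL h33 hS31 hSS goodSS_two_123B1 conductorNorm_lt_5000_123B1 not_hasCM_123B1 (analyticRank_123B1 h33 htab hGZK)
    twoTorsion_123B1 K hK (by rw [hdK]; decide) (satisfiesHeegnerHypothesis_123B1 hK.1 hdK) Dt H ι P hP j hstar (krizLi_loc_123B1 Dt) hd hsign W₂ hW₂

/-- **The witness member `123b1^{(29)}`** (rank one): `r_an = 1 ∧ ¬CM ∧ BSD(·, 2)` modulo PRINT + item 19097. BSD is not proved by any of this.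
[cite: KrizLi2019, Thm. 5.1 (2), Thm. 4.3, §6 Table 1 (row 123b1)] [cite: CreutzMiller2012, Thm. 1.1] -/
theorem rankOneMember_witness_123B1_of_ssWall (hKL : KrizLi2019.thm112_bsdTwo_twist) (h33 : KrizLi2019.thm33_rank_twist)
    (htab : KrizLi2019.table1_row123b1) (hS31 : bsdTriple_of_analyticRank_le_one_of_conductor_lt)
    (hGZK : rank_eq_analyticRank_of_analyticRank_le_one)
    (hSS : ∀ (W : WeierstrassCurve ℚ) [W.IsElliptic] [W.IsGloballyMinimal], ¬ W.HasCM → W.analyticRank = 0 →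
      (haveI : Fact (Nat.Prime 2) := ⟨Nat.prime_two⟩; GoodSS W 2) → BSDp W 2)
    (K : Type) [Field K] [NumberField K] (hK : IsImaginaryQuadratic K) (hdK : NumberField.discr K = -23)
    (W₁ : WeierstrassCurve ℚ) [W₁.IsElliptic] [W₁.IsGloballyMinimal]
    (hW₁ : ∃ C : VariableChange ℚ, C • (⟨0, -1, 1, 1, -1⟩ : WeierstrassCurve ℚ).quadraticTwist ((29 : ℤ) : ℚ) = W₁) :
    W₁.analyticRank = 1 ∧ ¬ W₁.HasCM ∧ BSDp W₁ 2 :=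
  rankOneMembers_123B1_of_ssWall hKL h33 htab hS31 hGZK hSS K hK hdK (inN_witness_123B1 hK.1 hdK) sign_witness_123B1 W₁ hW₁

end A123B1

/-! ## `141a1` -/
section A141A1
open Summit.BirchSwinnertonDyer.BirchSwinnertonDyer.Theorems.GenusExact.TwinSwap.KrizLiAnchor141a1

/-- **`141a1` is good SUPERSINGULAR at `2`** (`a₁ = 0` on the minimal model, good reduction at `2`). [cite: SilvermanAEC2009, V.4] [cite: KrizLi2019, §6 Example 6.2 and Table 1 (row 141a1)] -/
theorem goodSS_two_141A1 :
    haveI := isGloballyMinimal_141A1; haveI : Fact (Nat.Prime 2) := ⟨Nat.prime_two⟩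
    GoodSS (⟨0, 1, 1, -12, 2⟩ : WeierstrassCurve ℚ) 2 := by
  haveI := isElliptic_141A1; haveI := isGloballyMinimal_141A1
  exact goodSS_two_of_even_a₁ _ hasGoodReductionAtPrime_two_141A1 (by rw [intModel_141A1]; exact ⟨0, rfl⟩)

/-- ★ **THE RANK-ONE MEMBERS `141a1^{(d)}` — U₂-class curves settled MODULO PRINT + THE SUPERSINGULAR WALL ROW (19097) ALONE**: at every global minimal
`W₁ ≅ 141a1^{(d)}` (`d ∈ 𝒩(141a1, K)`, `d_K = -23`, `χ_d(−141) = 1`): `r_an(W₁) = 1 ∧ ¬CM ∧ BSD(W₁, 2)`.  BSD is not proved by any of this; U₂ is not proved.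
[cite: KrizLi2019, Thm. 5.1 (2), Thm. 4.3, §6 Table 1 (row 141a1)] [cite: CreutzMiller2012, Thm. 1.1] -/
theorem rankOneMembers_141A1_of_ssWall (hKL : KrizLi2019.thm112_bsdTwo_twist) (h33 : KrizLi2019.thm33_rank_twist)
    (htab : KrizLi2019.table1_row141a1) (hS31 : bsdTriple_of_analyticRank_le_one_of_conductor_lt)
    (hGZK : rank_eq_analyticRank_of_analyticRank_le_one)
    (hSS : ∀ (W : WeierstrassCurve ℚ) [W.IsElliptic] [W.IsGloballyMinimal], ¬ W.HasCM → W.analyticRank = 0 →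
      (haveI : Fact (Nat.Prime 2) := ⟨Nat.prime_two⟩; GoodSS W 2) → BSDp W 2)
    (K : Type) [Field K] [NumberField K] (hK : IsImaginaryQuadratic K) (hdK : NumberField.discr K = -23)
    {d : ℤ} (hd : haveI := isGloballyMinimal_141A1; KrizLi2019.InN (⟨0, 1, 1, -12, 2⟩ : WeierstrassCurve ℚ) K d)
    (hsign : haveI := isElliptic_141A1; Int.sign d * jacobiSym ((⟨0, 1, 1, -12, 2⟩ : WeierstrassCurve ℚ).conductorNorm ℤ) d.natAbs = 1)
    (W₁ : WeierstrassCurve ℚ) [W₁.IsElliptic] [W₁.IsGloballyMinimal]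
    (hW₁ : ∃ C : VariableChange ℚ, C • (⟨0, 1, 1, -12, 2⟩ : WeierstrassCurve ℚ).quadraticTwist (d : ℚ) = W₁) :
    W₁.analyticRank = 1 ∧ ¬ W₁.HasCM ∧ BSDp W₁ 2 := by
  haveI := isElliptic_141A1; haveI := isGloballyMinimal_141A1
  obtain ⟨_, Dt, H, ι, P, j, -, hP, hstar⟩ := htab K hK hdK
  exact rankOneMembers_of_ssWall _ hKL h33 hS31 hSS goodSS_two_141A1 conductorNorm_lt_5000_141A1 not_hasCM_141A1 (analyticRank_141A1 h33 htab hGZK)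
    twoTorsion_141A1 K hK (by rw [hdK]; decide) (satisfiesHeegnerHypothesis_141A1 hK.1 hdK) Dt H ι P hP j hstar (krizLi_loc_141A1 Dt) hd hsign W₁ hW₁

/-- **THE RANK-ZERO COMPANIONS `141a1^{(-23d)}`** under the supersingular wall row: `r_an = 0 ∧ ¬CM ∧ GoodSS ∧ BSD(·, 2)` — members of item 19097's own class.
BSD is not proved by any of this. [cite: KrizLi2019, Thm. 5.1 (2), Thm. 4.3, §6 Table 1 (row 141a1)] [cite: CreutzMiller2012, Thm. 1.1] -/
theorem rankZeroCompanions_141A1_of_ssWall (hKL : KrizLi2019.thm112_bsdTwo_twist) (h33 : KrizLi2019.thm33_rank_twist)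
    (htab : KrizLi2019.table1_row141a1) (hS31 : bsdTriple_of_analyticRank_le_one_of_conductor_lt)
    (hGZK : rank_eq_analyticRank_of_analyticRank_le_one)
    (hSS : ∀ (W : WeierstrassCurve ℚ) [W.IsElliptic] [W.IsGloballyMinimal], ¬ W.HasCM → W.analyticRank = 0 →
      (haveI : Fact (Nat.Prime 2) := ⟨Nat.prime_two⟩; GoodSS W 2) → BSDp W 2)
    (K : Type) [Field K] [NumberField K] (hK : IsImaginaryQuadratic K) (hdK : NumberField.discr K = -23)
    {d : ℤ} (hd : haveI := isGloballyMinimal_141A1; KrizLi2019.InN (⟨0, 1, 1, -12, 2⟩ : WeierstrassCurve ℚ) K d)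
    (hsign : haveI := isElliptic_141A1; Int.sign d * jacobiSym ((⟨0, 1, 1, -12, 2⟩ : WeierstrassCurve ℚ).conductorNorm ℤ) d.natAbs = 1)
    (W₂ : WeierstrassCurve ℚ) [W₂.IsElliptic] [W₂.IsGloballyMinimal]
    (hW₂ : ∃ C : VariableChange ℚ, C • (⟨0, 1, 1, -12, 2⟩ : WeierstrassCurve ℚ).quadraticTwist ((d * NumberField.discr K : ℤ) : ℚ) = W₂) :
    haveI : Fact (Nat.Prime 2) := ⟨Nat.prime_two⟩
    W₂.analyticRank = 0 ∧ ¬ W₂.HasCM ∧ GoodSS W₂ 2 ∧ BSDp W₂ 2 := by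
  haveI := isElliptic_141A1; haveI := isGloballyMinimal_141A1
  obtain ⟨_, Dt, H, ι, P, j, -, hP, hstar⟩ := htab K hK hdK
  exact rankZeroCompanions_of_ssWall _ hKL h33 hS31 hSS goodSS_two_141A1 conductorNorm_lt_5000_141A1 not_hasCM_141A1 (analyticRank_141A1 h33 htab hGZK)
    twoTorsion_141A1 K hK (by rw [hdK]; decide) (satisfiesHeegnerHypothesis_141A1 hK.1 hdK) Dt H ι P hP j hstar (krizLi_loc_141A1 Dt) hd hsign W₂ hW₂

/-- **The witness member `141a1^{(29)}`** (rank one): `r_an = 1 ∧ ¬CM ∧ BSD(·, 2)` modulo PRINT + item 19097. BSD is not proved by any of this.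
[cite: KrizLi2019, Thm. 5.1 (2), Thm. 4.3, §6 Table 1 (row 141a1)] [cite: CreutzMiller2012, Thm. 1.1] -/
theorem rankOneMember_witness_141A1_of_ssWall (hKL : KrizLi2019.thm112_bsdTwo_twist) (h33 : KrizLi2019.thm33_rank_twist)
    (htab : KrizLi2019.table1_row141a1) (hS31 : bsdTriple_of_analyticRank_le_one_of_conductor_lt)
    (hGZK : rank_eq_analyticRank_of_analyticRank_le_one)
    (hSS : ∀ (W : WeierstrassCurve ℚ) [W.IsElliptic] [W.IsGloballyMinimal], ¬ W.HasCM → W.analyticRank = 0 →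
      (haveI : Fact (Nat.Prime 2) := ⟨Nat.prime_two⟩; GoodSS W 2) → BSDp W 2)
    (K : Type) [Field K] [NumberField K] (hK : IsImaginaryQuadratic K) (hdK : NumberField.discr K = -23)
    (W₁ : WeierstrassCurve ℚ) [W₁.IsElliptic] [W₁.IsGloballyMinimal]
    (hW₁ : ∃ C : VariableChange ℚ, C • (⟨0, 1, 1, -12, 2⟩ : WeierstrassCurve ℚ).quadraticTwist ((29 : ℤ) : ℚ) = W₁) :
    W₁.analyticRank = 1 ∧ ¬ W₁.HasCM ∧ BSDp W₁ 2 :=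
  rankOneMembers_141A1_of_ssWall hKL h33 htab hS31 hGZK hSS K hK hdK (inN_witness_141A1 hK.1 hdK) sign_witness_141A1 W₁ hW₁

end A141A1

/-! ## `141d1` -/
section A141D1
open Summit.BirchSwinnertonDyer.BirchSwinnertonDyer.Theorems.GenusExact.TwinSwap.KrizLiAnchor141d1

/-- **`141d1` is good SUPERSINGULAR at `2`** (`a₁ = 0` on the minimal model, good reduction at `2`). [cite: SilvermanAEC2009, V.4] [cite: KrizLi2019, §6 Example 6.2 and Table 1 (row 141d1)] -/
theorem goodSS_two_141D1 :
    haveI := isGloballyMinimal_141D1; haveI : Fact (Nat.Prime 2) := ⟨Nat.prime_two⟩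
    GoodSS (⟨0, -1, 1, -1, 0⟩ : WeierstrassCurve ℚ) 2 := by
  haveI := isElliptic_141D1; haveI := isGloballyMinimal_141D1
  exact goodSS_two_of_even_a₁ _ hasGoodReductionAtPrime_two_141D1 (by rw [intModel_141D1]; exact ⟨0, rfl⟩)

/-- ★ **THE RANK-ONE MEMBERS `141d1^{(d)}` — U₂-class curves settled MODULO PRINT + THE SUPERSINGULAR WALL ROW (19097) ALONE**: at every global minimal
`W₁ ≅ 141d1^{(d)}` (`d ∈ 𝒩(141d1, K)`, `d_K = -23`, `χ_d(−141) = 1`): `r_an(W₁) = 1 ∧ ¬CM ∧ BSD(W₁, 2)`.  BSD is not proved by any of this; U₂ is not proved.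
[cite: KrizLi2019, Thm. 5.1 (2), Thm. 4.3, §6 Table 1 (row 141d1)] [cite: CreutzMiller2012, Thm. 1.1] -/
theorem rankOneMembers_141D1_of_ssWall (hKL : KrizLi2019.thm112_bsdTwo_twist) (h33 : KrizLi2019.thm33_rank_twist)
    (htab : KrizLi2019.table1_row141d1) (hS31 : bsdTriple_of_analyticRank_le_one_of_conductor_lt)
    (hGZK : rank_eq_analyticRank_of_analyticRank_le_one)
    (hSS : ∀ (W : WeierstrassCurve ℚ) [W.IsElliptic] [W.IsGloballyMinimal], ¬ W.HasCM → W.analyticRank = 0 →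
      (haveI : Fact (Nat.Prime 2) := ⟨Nat.prime_two⟩; GoodSS W 2) → BSDp W 2)
    (K : Type) [Field K] [NumberField K] (hK : IsImaginaryQuadratic K) (hdK : NumberField.discr K = -23)
    {d : ℤ} (hd : haveI := isGloballyMinimal_141D1; KrizLi2019.InN (⟨0, -1, 1, -1, 0⟩ : WeierstrassCurve ℚ) K d)
    (hsign : haveI := isElliptic_141D1; Int.sign d * jacobiSym ((⟨0, -1, 1, -1, 0⟩ : WeierstrassCurve ℚ).conductorNorm ℤ) d.natAbs = 1)
    (W₁ : WeierstrassCurve ℚ) [W₁.IsElliptic] [W₁.IsGloballyMinimal]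
    (hW₁ : ∃ C : VariableChange ℚ, C • (⟨0, -1, 1, -1, 0⟩ : WeierstrassCurve ℚ).quadraticTwist (d : ℚ) = W₁) :
    W₁.analyticRank = 1 ∧ ¬ W₁.HasCM ∧ BSDp W₁ 2 := by
  haveI := isElliptic_141D1; haveI := isGloballyMinimal_141D1
  obtain ⟨_, Dt, H, ι, P, j, -, hP, hstar⟩ := htab K hK hdK
  exact rankOneMembers_of_ssWall _ hKL h33 hS31 hSS goodSS_two_141D1 conductorNorm_lt_5000_141D1 not_hasCM_141D1 (analyticRank_141D1 h33 htab hGZK)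
    twoTorsion_141D1 K hK (by rw [hdK]; decide) (satisfiesHeegnerHypothesis_141D1 hK.1 hdK) Dt H ι P hP j hstar (krizLi_loc_141D1 Dt) hd hsign W₁ hW₁

/-- **THE RANK-ZERO COMPANIONS `141d1^{(-23d)}`** under the supersingular wall row: `r_an = 0 ∧ ¬CM ∧ GoodSS ∧ BSD(·, 2)` — members of item 19097's own class.
BSD is not proved by any of this. [cite: KrizLi2019, Thm. 5.1 (2), Thm. 4.3, §6 Table 1 (row 141d1)] [cite: CreutzMiller2012, Thm. 1.1] -/
theorem rankZeroCompanions_141D1_of_ssWall (hKL : KrizLi2019.thm112_bsdTwo_twist) (h33 : KrizLi2019.thm33_rank_twist)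
    (htab : KrizLi2019.table1_row141d1) (hS31 : bsdTriple_of_analyticRank_le_one_of_conductor_lt)
    (hGZK : rank_eq_analyticRank_of_analyticRank_le_one)
    (hSS : ∀ (W : WeierstrassCurve ℚ) [W.IsElliptic] [W.IsGloballyMinimal], ¬ W.HasCM → W.analyticRank = 0 →
      (haveI : Fact (Nat.Prime 2) := ⟨Nat.prime_two⟩; GoodSS W 2) → BSDp W 2)
    (K : Type) [Field K] [NumberField K] (hK : IsImaginaryQuadratic K) (hdK : NumberField.discr K = -23)
    {d : ℤ} (hd : haveI := isGloballyMinimal_141D1; KrizLi2019.InN (⟨0, -1, 1, -1, 0⟩ : WeierstrassCurve ℚ) K d)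
    (hsign : haveI := isElliptic_141D1; Int.sign d * jacobiSym ((⟨0, -1, 1, -1, 0⟩ : WeierstrassCurve ℚ).conductorNorm ℤ) d.natAbs = 1)
    (W₂ : WeierstrassCurve ℚ) [W₂.IsElliptic] [W₂.IsGloballyMinimal]
    (hW₂ : ∃ C : VariableChange ℚ, C • (⟨0, -1, 1, -1, 0⟩ : WeierstrassCurve ℚ).quadraticTwist ((d * NumberField.discr K : ℤ) : ℚ) = W₂) :
    haveI : Fact (Nat.Prime 2) := ⟨Nat.prime_two⟩
    W₂.analyticRank = 0 ∧ ¬ W₂.HasCM ∧ GoodSS W₂ 2 ∧ BSDp W₂ 2 := by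
  haveI := isElliptic_141D1; haveI := isGloballyMinimal_141D1
  obtain ⟨_, Dt, H, ι, P, j, -, hP, hstar⟩ := htab K hK hdK
  exact rankZeroCompanions_of_ssWall _ hKL h33 hS31 hSS goodSS_two_141D1 conductorNorm_lt_5000_141D1 not_hasCM_141D1 (analyticRank_141D1 h33 htab hGZK)
    twoTorsion_141D1 K hK (by rw [hdK]; decide) (satisfiesHeegnerHypothesis_141D1 hK.1 hdK) Dt H ι P hP j hstar (krizLi_loc_141D1 Dt) hd hsign W₂ hW₂

/-- **The witness member `141d1^{(29)}`** (rank one): `r_an = 1 ∧ ¬CM ∧ BSD(·, 2)` modulo PRINT + item 19097. BSD is not proved by any of this.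
[cite: KrizLi2019, Thm. 5.1 (2), Thm. 4.3, §6 Table 1 (row 141d1)] [cite: CreutzMiller2012, Thm. 1.1] -/
theorem rankOneMember_witness_141D1_of_ssWall (hKL : KrizLi2019.thm112_bsdTwo_twist) (h33 : KrizLi2019.thm33_rank_twist)
    (htab : KrizLi2019.table1_row141d1) (hS31 : bsdTriple_of_analyticRank_le_one_of_conductor_lt)
    (hGZK : rank_eq_analyticRank_of_analyticRank_le_one)
    (hSS : ∀ (W : WeierstrassCurve ℚ) [W.IsElliptic] [W.IsGloballyMinimal], ¬ W.HasCM → W.analyticRank = 0 →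
      (haveI : Fact (Nat.Prime 2) := ⟨Nat.prime_two⟩; GoodSS W 2) → BSDp W 2)
    (K : Type) [Field K] [NumberField K] (hK : IsImaginaryQuadratic K) (hdK : NumberField.discr K = -23)
    (W₁ : WeierstrassCurve ℚ) [W₁.IsElliptic] [W₁.IsGloballyMinimal]
    (hW₁ : ∃ C : VariableChange ℚ, C • (⟨0, -1, 1, -1, 0⟩ : WeierstrassCurve ℚ).quadraticTwist ((29 : ℤ) : ℚ) = W₁) :
    W₁.analyticRank = 1 ∧ ¬ W₁.HasCM ∧ BSDp W₁ 2 :=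
  rankOneMembers_141D1_of_ssWall hKL h33 htab hS31 hGZK hSS K hK hdK (inN_witness_141D1 hK.1 hdK) sign_witness_141D1 W₁ hW₁

end A141D1


end Summit.BirchSwinnertonDyer.BirchSwinnertonDyer.Theorems.GenusExact.TwinSwap.KrizLiAnchorsSSIIa

end
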